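import Mathlib
import HarnessLib
import Summits.Ventures.LatticeQCDFlow.Exactness.NCMCGeneralSpaceMonotoneRootChainCLT
import Summits.Ventures.LatticeQCDFlow.Exactness.NCMCGeneralSpaceBennettRootCLT
import Summits.Ventures.LatticeQCDFlow.Exactness.NCMCGeneralSpaceBennettRootVariance

/-!
# The BAR lane along CORRELATED starts: the self-consistent Bennett estimate from two independent streams of correlated launches is asymptotically normal, `√n (ΔF̂_n − ΔF) ⇒ N(0, σ²_pair / G²)`, from EVERY initial law of the first record pair

HONEST FRAMING: exact (Metropolis-corrected) sampling algorithms for lattice gauge theory;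
figures of merit are autocorrelation/cost numbers at stated couplings and volumes; no
continuum-physics claim.

Venture `LatticeQCDFlow` (cell pub-lqcd), topic `Exactness`; FANOUT row 13 (`eng-snf`, GEN-22).
NEW WORK of the cell, not a published result; no definition is introduced; nothing is cited as a
fact (Bennett 1976 NAMED ONLY).  GEN-15 typed the CLT of the BAR root for INDEPENDENT paired
evolutions (`NCMCGeneralSpaceBennettRootCLT`: variance `1/G − 2`, Bennett's bound); GEN-16/18 its
almost-sure convergence along two independent restart chains of CORRELATED launches from every pair
of starts (`NCMCGeneralSpaceBarPairsEveryStart`).  This file is the CLT along the chains — the BAR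
companion of `NCMCGeneralSpaceRestartChainCLT.lean`: the pair chain
`(R₀ ∥ₖ R₁)`, `R₀ = (κF ∘ₖ K₀).comap s`, `R₁ = (κR ∘ₖ K₁).comap e`, is minorised in one step by the
product measure (GEN-18 `smul_normalised_prod_le_nHit_one`) and leaves `P_F ⊗ P_R` invariant
(GEN-16 `invariant_parallelComp`), the Bennett summand `ψ_d(ω, ω') = σ(d − W ω) − σ(W ω' − d)` is
bounded, strictly increasing, with population root `ΔF` and the Taylor bound of GEN-15
(`abs_barSummand_taylor_le`, `L = ½`), its `d`-derivative at the root integrates to the OVERLAP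
`G = E_F σ(ΔF − W)` (GEN-15 `barSensitivity_eq_overlap`) — so GEN-22's chain root CLT
(`tendstoInDistribution_sqrt_mul_root_sub_of_nHit`) applies.

## Content (Crooks pair between finite weights, `Z₀, Z₁ ≠ 0`, `e^{−ΔF} = Z₁/Z₀`; `K₀` `ν₀`-invariant
## and `K₁` `ν₁`-invariant Markov level samplers dominating non-zero finite `m₀`, `m₁` from every
## configuration; the two record streams run INDEPENDENTLY, paired index by index; `d̂_n` ANY measurable
## root selection of the sample Bennett equation `Σ_{i<n} σ(d − W_i) = Σ_{i<n} σ(W'_i − d)`, `n ≥ 1`)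

* **`CrooksPair.tendstoInDistribution_sqrt_mul_barRoot_sub_restartChains`** — for EVERY initial law
  `μ₀` of the first record pair and every `Y ~ N(0, σ²_pair / G²)`,
  `σ²_pair = ∫ ψ_{ΔF}² d(P_F ⊗ P_R) + 2 Σ_{k≥0} ∫ ψ_{ΔF} · (kop (R₀ ∥ₖ R₁))^[k+1] ψ_{ΔF} d(P_F ⊗ P_R)`:
  `√n (ΔF̂_n − ΔF) ⇒ Y` under the chain law of the record pairs;
  **`…_everyStart`** — first forward record launched from ANY `x`, first reverse record from ANY `y`.

Reading (value-free): the honest large-`n` error bar of BAR from two correlated streams is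
`√(σ²_pair/(G² n))`; with independent launches `σ²_pair = G(1 − 2G)` and the figure is Bennett's
`(1/G − 2)/n` (GEN-15).  NOT CLAIMED: a consistent estimator of `σ²_pair`; unequal stream lengths;
the block (`a : b`) equation; `σ²_pair > 0`; anything numerical.
-/

namespace Summit.Ventures.LatticeQCDFlow.Exactness.GeneralNCMC

open MeasureTheory ProbabilityTheory Set Filter Finset
open scoped ENNReal NNReal Topology

variable {Ω E : Type*} [MeasurableSpace Ω] [MeasurableSpace E]

namespace CrooksPair

variable {ν₀ ν₁ : Measure Ω} [IsFiniteMeasure ν₀] [IsFiniteMeasure ν₁] {κF κR : Kernel Ω E}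
  [IsMarkovKernel κF] [IsMarkovKernel κR] {s e : E → Ω} {W : E → ℝ}
variable {Ω' : Type*} [MeasurableSpace Ω'] {P' : Measure Ω'} [IsProbabilityMeasure P']

/-- **ASYMPTOTIC NORMALITY OF THE BAR ESTIMATE ALONG TWO INDEPENDENT STREAMS OF CORRELATED LAUNCHES,
FROM EVERY INITIAL LAW OF THE FIRST RECORD PAIR.**  Crooks pair with `Z₀, Z₁ ≠ 0`,
`e^{−ΔF} = Z₁/Z₀`; `ν₀`-invariant `K₀` and `ν₁`-invariant `K₁` dominating non-zero finite `m₀`, `m₁`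
from every configuration; `d̂_n` any measurable root selection of the sample Bennett equation.
For every initial law `μ₀` on `E × E` and every `Y ~ N(0, σ²_pair / G²)` (`G = E_F σ(ΔF − W)` the
overlap, `σ²_pair` the Green–Kubo variance of the Bennett summand at `ΔF` along the pair chain):
`√n (d̂_n − ΔF) ⇒ Y`. -/
theorem tendstoInDistribution_sqrt_mul_barRoot_sub_restartChains (K₀ K₁ : Kernel Ω Ω)
    [IsMarkovKernel K₀] [IsMarkovKernel K₁] (h0 : ν₀ univ ≠ 0) (h1 : ν₁ univ ≠ 0)
    (hK₀ : Kernel.Invariant K₀ ν₀) (hK₁ : Kernel.Invariant K₁ ν₁) (h : CrooksPair ν₀ ν₁ κF κR s e W)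
    {ΔF : ℝ} (hΔF : Real.exp (-ΔF) = ((ν₀ univ)⁻¹ * ν₁ univ).toReal)
    {m₀ m₁ : Measure Ω} [IsFiniteMeasure m₀] [IsFiniteMeasure m₁] (hm₀ : m₀ univ ≠ 0)
    (hm₁ : m₁ univ ≠ 0) (hmin₀ : ∀ z, m₀ ≤ K₀ z) (hmin₁ : ∀ z, m₁ ≤ K₁ z)
    {dhat : ℕ → (ℕ → E × E) → ℝ} (hdm : ∀ n, Measurable (dhat n))
    (hdhat : ∀ n, 1 ≤ n → ∀ ω, (∑ i ∈ range n, Real.sigmoid (dhat n ω - W (ω i).1)) -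
      ∑ i ∈ range n, Real.sigmoid (W (ω i).2 - dhat n ω) = 0)
    (μ₀ : Measure (E × E)) [IsProbabilityMeasure μ₀] {Y : Ω' → ℝ}
    (hY : HasLaw Y (gaussianReal 0 (Real.toNNReal
      (((∫ p, (Real.sigmoid (ΔF - W p.1) - Real.sigmoid (W p.2 - ΔF)) ^ 2
          ∂((fwdPathLaw ν₀ κF).prod (fwdPathLaw ν₁ κR)))
        + 2 * ∑' k, ∫ p, (Real.sigmoid (ΔF - W p.1) - Real.sigmoid (W p.2 - ΔF))
          * (Scoring.kop (((κF ∘ₖ K₀).comap s h.measurable_s) ∥ₖ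
              ((κR ∘ₖ K₁).comap e h.measurable_e)))^[k + 1]
            (fun p => Real.sigmoid (ΔF - W p.1) - Real.sigmoid (W p.2 - ΔF)) p
          ∂((fwdPathLaw ν₀ κF).prod (fwdPathLaw ν₁ κR)))
        / (∫ ε, Real.sigmoid (ΔF - W ε) ∂(fwdPathLaw ν₀ κF)) ^ 2))) P')
    [IsProbabilityMeasure (Kernel.trajMeasure (X := fun _ : ℕ => E × E) μ₀
        (fun n : ℕ => (((κF ∘ₖ K₀).comap s h.measurable_s) ∥ₖ ((κR ∘ₖ K₁).comap e h.measurable_e)).comap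
          (fun hh : (j : ↥(Finset.Iic n)) → E × E => hh ⟨n, Finset.mem_Iic.2 le_rfl⟩)
          (measurable_pi_apply _)))] :
    TendstoInDistribution (fun (n : ℕ) (ω : ℕ → E × E) => √(n : ℝ) * (dhat n ω - ΔF)) atTop Y
      (fun _ => Kernel.trajMeasure (X := fun _ : ℕ => E × E) μ₀
        (fun n : ℕ => (((κF ∘ₖ K₀).comap s h.measurable_s) ∥ₖ ((κR ∘ₖ K₁).comap e h.measurable_e)).comap
          (fun hh : (j : ↥(Finset.Iic n)) → E × E => hh ⟨n, Finset.mem_Iic.2 le_rfl⟩)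
          (measurable_pi_apply _))) P' := by
  haveI := isProbabilityMeasure_fwdPathLaw ν₀ h0 κF
  haveI := isProbabilityMeasure_fwdPathLaw ν₁ h1 κR
  -- the pair chain: invariance and one-step minorisation (GEN-16 / GEN-18)
  have hI₀ := h.invariant_restartKernel K₀ hK₀
  have hI₁ := h.invariant_restartKernel_rev K₁ hK₁
  have hinv := invariant_parallelComp _ _ hI₀ hI₁
  haveI : IsFiniteMeasure (m₀.bind κF) := inferInstance
  haveI : IsFiniteMeasure (m₁.bind κR) := inferInstance
  have hprod : ((m₀.bind κF).prod (m₁.bind κR)) univ ≠ 0 :=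
    prod_apply_univ_ne_zero (by rw [bind_apply_univ_of_markov]; exact hm₀)
      (by rw [bind_apply_univ_of_markov]; exact hm₁)
  haveI : IsProbabilityMeasure ((((m₀.bind κF).prod (m₁.bind κR)) univ)⁻¹ •
      (m₀.bind κF).prod (m₁.bind κR)) :=
    ⟨by rw [Measure.smul_apply, smul_eq_mul, ENNReal.inv_mul_cancel hprod (measure_ne_top _ _)]⟩
  have hD := smul_normalised_prod_le_nHit_one ((κF ∘ₖ K₀).comap s h.measurable_s)
    ((κR ∘ₖ K₁).comap e h.measurable_e) hprod (measure_le_comp_comap K₀ κF h.measurable_s hmin₀)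
    (measure_le_comp_comap K₁ κR h.measurable_e hmin₁)
  -- the estimating family, its root and its derivative at the root
  have hσm : Measurable Real.sigmoid := _root_.continuous_sigmoid.measurable
  have hm1 : ∀ d : ℝ, Measurable fun p : E × E => d - W p.1 :=
    fun d => measurable_const.sub (h.measurable_W.comp measurable_fst)
  have hm2 : ∀ d : ℝ, Measurable fun p : E × E => W p.2 - d :=
    fun d => (h.measurable_W.comp measurable_snd).sub measurable_const
  have hmeas : ∀ d, Measurable fun p : E × E => Real.sigmoid (d - W p.1) - Real.sigmoid (W p.2 - d) :=
    fun d => (hσm.comp (hm1 d)).sub (hσm.comp (hm2 d))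
  have hint : ∀ d, Integrable (fun p : E × E => Real.sigmoid (d - W p.1) - Real.sigmoid (W p.2 - d)) ((fwdPathLaw ν₀ κF).prod (fwdPathLaw ν₁ κR)) :=
    fun d => (integrable_sigmoid_comp (hm1 d)).sub (integrable_sigmoid_comp (hm2 d))
  have hCψ : ∀ p : E × E, |Real.sigmoid (ΔF - W p.1) - Real.sigmoid (W p.2 - ΔF)| ≤ 2 := fun p =>
    calc |Real.sigmoid (ΔF - W p.1) - Real.sigmoid (W p.2 - ΔF)|
        ≤ |Real.sigmoid (ΔF - W p.1)| + |Real.sigmoid (W p.2 - ΔF)| := abs_sub _ _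
      _ ≤ 1 + 1 := add_le_add (by rw [abs_of_nonneg (Real.sigmoid_nonneg _)]; exact Real.sigmoid_le_one _)
          (by rw [abs_of_nonneg (Real.sigmoid_nonneg _)]; exact Real.sigmoid_le_one _)
      _ = 2 := by norm_num
  have hroot : ∫ p, (Real.sigmoid (ΔF - W p.1) - Real.sigmoid (W p.2 - ΔF)) ∂((fwdPathLaw ν₀ κF).prod (fwdPathLaw ν₁ κR)) = 0 := by
    have hmarg := chain_map_eval_of_invariant _ hinv 0
    rw [← hmarg, integral_barSummand_eq h.measurable_W (map_fst_eval_chain_prod _ _ hI₀ hI₁)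
      (map_snd_eval_chain_prod _ _ hI₀ hI₁), (h.integral_sigmoid_fwd_eq_rev_iff h0 h1 hΔF ΔF).2 rfl,
      sub_self]
  set φ : E × E → ℝ := fun p => Real.sigmoid (ΔF - W p.1) * (1 - Real.sigmoid (ΔF - W p.1)) +
    Real.sigmoid (W p.2 - ΔF) * (1 - Real.sigmoid (W p.2 - ΔF)) with hφ
  have hφm : Measurable φ :=
    ((hσm.comp (hm1 ΔF)).mul (measurable_const.sub (hσm.comp (hm1 ΔF)))).add
      ((hσm.comp (hm2 ΔF)).mul (measurable_const.sub (hσm.comp (hm2 ΔF))))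
  have hφbound : ∀ p, |φ p| ≤ 1 / 2 := fun p => by
    have ha := dsigmoid_mem_Icc (ΔF - W p.1)
    have hb := dsigmoid_mem_Icc (W p.2 - ΔF)
    rw [abs_of_nonneg (add_nonneg ha.1 hb.1)]
    linarith [ha.2, hb.2]
  -- `E_((fwdPathLaw ν₀ κF).prod (fwdPathLaw ν₁ κR)) φ = G`, the overlap (GEN-15), and `G > 0`
  have hj1 : Integrable (fun p : E × E => Real.sigmoid (ΔF - W p.1) * (1 - Real.sigmoid (ΔF - W p.1))) ((fwdPathLaw ν₀ κF).prod (fwdPathLaw ν₁ κR)) := by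
    have := integrable_sigmoid_mul_sigmoid (μ := ((fwdPathLaw ν₀ κF).prod (fwdPathLaw ν₁ κR))) (f := fun p : E × E => ΔF - W p.1)
      (g := fun p : E × E => W p.1 - ΔF) (hm1 ΔF) ((h.measurable_W.comp measurable_fst).sub measurable_const)
    refine this.congr (Eventually.of_forall fun p => ?_)
    simp only
    rw [one_sub_sigmoid_sub (W p.1) ΔF]
  have hj2 : Integrable (fun p : E × E => Real.sigmoid (W p.2 - ΔF) * (1 - Real.sigmoid (W p.2 - ΔF))) ((fwdPathLaw ν₀ κF).prod (fwdPathLaw ν₁ κR)) := by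
    have := integrable_sigmoid_mul_sigmoid (μ := ((fwdPathLaw ν₀ κF).prod (fwdPathLaw ν₁ κR))) (f := fun p : E × E => W p.2 - ΔF)
      (g := fun p : E × E => ΔF - W p.2) (hm2 ΔF) (measurable_const.sub (h.measurable_W.comp measurable_snd))
    refine this.congr (Eventually.of_forall fun p => ?_)
    simp only
    rw [one_sub_sigmoid_sub ΔF (W p.2)]
  have hφmean : ∫ p, φ p ∂((fwdPathLaw ν₀ κF).prod (fwdPathLaw ν₁ κR)) = ∫ ε, Real.sigmoid (ΔF - W ε) ∂(fwdPathLaw ν₀ κF) := by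
    rw [← h.barSensitivity_eq_overlap h0 h1 hΔF, hφ]
    simp only
    rw [integral_add hj1 hj2,
      integral_comp_of_measurePreserving (measurePreserving_fst (μ := fwdPathLaw ν₀ κF)
        (ν := fwdPathLaw ν₁ κR))
        (g := fun a => Real.sigmoid (ΔF - W a) * (1 - Real.sigmoid (ΔF - W a)))
        ((hσm.comp (measurable_const.sub h.measurable_W)).mul
          (measurable_const.sub (hσm.comp (measurable_const.sub h.measurable_W)))).aestronglyMeasurable,
      integral_comp_of_measurePreserving (measurePreserving_snd (μ := fwdPathLaw ν₀ κF)
        (ν := fwdPathLaw ν₁ κR))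
        (g := fun a => Real.sigmoid (W a - ΔF) * (1 - Real.sigmoid (W a - ΔF)))
        ((hσm.comp (h.measurable_W.sub measurable_const)).mul
          (measurable_const.sub (hσm.comp (h.measurable_W.sub measurable_const)))).aestronglyMeasurable]
  have hG : 0 < ∫ p, φ p ∂((fwdPathLaw ν₀ κF).prod (fwdPathLaw ν₁ κR)) := by rw [hφmean]; exact h.overlap_pos h0 ΔF
  -- the Taylor bound (GEN-15), and the chain root CLT
  have htaylor : ∀ (p : E × E) (d' : ℝ),
      |(Real.sigmoid (d' - W p.1) - Real.sigmoid (W p.2 - d')) -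
        (Real.sigmoid (ΔF - W p.1) - Real.sigmoid (W p.2 - ΔF)) - φ p * (d' - ΔF)|
        ≤ 1 / 2 * (d' - ΔF) ^ 2 := fun p d' => abs_barSummand_taylor_le (W p.1) (W p.2) ΔF d'
  have hY' : HasLaw Y (gaussianReal 0 (Real.toNNReal
      (((∫ p, (Real.sigmoid (ΔF - W p.1) - Real.sigmoid (W p.2 - ΔF)) ^ 2 ∂((fwdPathLaw ν₀ κF).prod (fwdPathLaw ν₁ κR)))
        + 2 * ∑' k, ∫ p, (Real.sigmoid (ΔF - W p.1) - Real.sigmoid (W p.2 - ΔF))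
          * (Scoring.kop (((κF ∘ₖ K₀).comap s h.measurable_s) ∥ₖ
              ((κR ∘ₖ K₁).comap e h.measurable_e)))^[k + 1]
            (fun p => Real.sigmoid (ΔF - W p.1) - Real.sigmoid (W p.2 - ΔF)) p ∂((fwdPathLaw ν₀ κF).prod (fwdPathLaw ν₁ κR)))
        / (∫ p, φ p ∂((fwdPathLaw ν₀ κF).prod (fwdPathLaw ν₁ κR))) ^ 2))) P' := by
    rw [hφmean]; exact hY
  exact tendstoInDistribution_sqrt_mul_root_sub_of_nHit (ψ := fun d (p : E × E) =>
      Real.sigmoid (d - W p.1) - Real.sigmoid (W p.2 - d)) hinv hprod hD Nat.one_pos hmeas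
    (barSummand_strictMono W) hint hroot hCψ hφm hφbound hG (by norm_num : (0 : ℝ) ≤ 1 / 2) htaylor
    hdm (fun n hn ω => by rw [← hdhat n hn ω, sum_sub_distrib]) μ₀ hY'

/-- **THE BAR LANE'S CLT FROM EVERY PAIR OF INITIAL CONFIGURATIONS** — the engine's form: first forward
record launched from ANY `x`, first reverse record from ANY `y` (`μ₀ = κF(x, ·) ⊗ κR(y, ·)`), then
`K₀` / `K₁` between launches on each leg: `√n (ΔF̂_n − ΔF) ⇒ Y` for every `Y ~ N(0, σ²_pair / G²)`. -/
theorem tendstoInDistribution_sqrt_mul_barRoot_sub_restartChains_everyStart (K₀ K₁ : Kernel Ω Ω)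
    [IsMarkovKernel K₀] [IsMarkovKernel K₁] (h0 : ν₀ univ ≠ 0) (h1 : ν₁ univ ≠ 0)
    (hK₀ : Kernel.Invariant K₀ ν₀) (hK₁ : Kernel.Invariant K₁ ν₁) (h : CrooksPair ν₀ ν₁ κF κR s e W)
    {ΔF : ℝ} (hΔF : Real.exp (-ΔF) = ((ν₀ univ)⁻¹ * ν₁ univ).toReal)
    {m₀ m₁ : Measure Ω} [IsFiniteMeasure m₀] [IsFiniteMeasure m₁] (hm₀ : m₀ univ ≠ 0)
    (hm₁ : m₁ univ ≠ 0) (hmin₀ : ∀ z, m₀ ≤ K₀ z) (hmin₁ : ∀ z, m₁ ≤ K₁ z)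
    {dhat : ℕ → (ℕ → E × E) → ℝ} (hdm : ∀ n, Measurable (dhat n))
    (hdhat : ∀ n, 1 ≤ n → ∀ ω, (∑ i ∈ range n, Real.sigmoid (dhat n ω - W (ω i).1)) -
      ∑ i ∈ range n, Real.sigmoid (W (ω i).2 - dhat n ω) = 0)
    (x y : Ω) {Y : Ω' → ℝ}
    (hY : HasLaw Y (gaussianReal 0 (Real.toNNReal
      (((∫ p, (Real.sigmoid (ΔF - W p.1) - Real.sigmoid (W p.2 - ΔF)) ^ 2
          ∂((fwdPathLaw ν₀ κF).prod (fwdPathLaw ν₁ κR)))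
        + 2 * ∑' k, ∫ p, (Real.sigmoid (ΔF - W p.1) - Real.sigmoid (W p.2 - ΔF))
          * (Scoring.kop (((κF ∘ₖ K₀).comap s h.measurable_s) ∥ₖ
              ((κR ∘ₖ K₁).comap e h.measurable_e)))^[k + 1]
            (fun p => Real.sigmoid (ΔF - W p.1) - Real.sigmoid (W p.2 - ΔF)) p
          ∂((fwdPathLaw ν₀ κF).prod (fwdPathLaw ν₁ κR)))
        / (∫ ε, Real.sigmoid (ΔF - W ε) ∂(fwdPathLaw ν₀ κF)) ^ 2))) P')
    [IsProbabilityMeasure (Kernel.trajMeasure (X := fun _ : ℕ => E × E) ((κF x).prod (κR y))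
        (fun n : ℕ => (((κF ∘ₖ K₀).comap s h.measurable_s) ∥ₖ ((κR ∘ₖ K₁).comap e h.measurable_e)).comap
          (fun hh : (j : ↥(Finset.Iic n)) → E × E => hh ⟨n, Finset.mem_Iic.2 le_rfl⟩)
          (measurable_pi_apply _)))] :
    TendstoInDistribution (fun (n : ℕ) (ω : ℕ → E × E) => √(n : ℝ) * (dhat n ω - ΔF)) atTop Y
      (fun _ => Kernel.trajMeasure (X := fun _ : ℕ => E × E) ((κF x).prod (κR y))
        (fun n : ℕ => (((κF ∘ₖ K₀).comap s h.measurable_s) ∥ₖ ((κR ∘ₖ K₁).comap e h.measurable_e)).comap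
          (fun hh : (j : ↥(Finset.Iic n)) → E × E => hh ⟨n, Finset.mem_Iic.2 le_rfl⟩)
          (measurable_pi_apply _))) P' :=
  h.tendstoInDistribution_sqrt_mul_barRoot_sub_restartChains K₀ K₁ h0 h1 hK₀ hK₁ hΔF hm₀ hm₁ hmin₀
    hmin₁ hdm hdhat ((κF x).prod (κR y)) hY

end CrooksPair

end Summit.Ventures.LatticeQCDFlow.Exactness.GeneralNCMC
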